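import Summits.ResolutionOfSingularities.ResolutionOfSingularities.Theorems.MarkedTransferCampaignW12SandwichRho
import Summits.ResolutionOfSingularities.ResolutionOfSingularities.Theorems.MarkedTransferCampaignG1PnegaInterfaceV3
import Mathlib.RingTheory.MvPolynomial.Basic
import Mathlib.Algebra.Polynomial.Div
import HarnessLib

/-!
# [OURS · L1 G1 · scored cell F2 `mul_mem` × SW / SWρ] KERNEL: the product rule FAILS for the Frobenius-sandwich negative pieces at a
# guarded affine-line model (kernel by res-type-017, res-D-plan-1 ROUTING #12 (a) 2026-08-27T02:56:49Z — scorer res-adj-1, carrier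
# res-L1-type-o2; HOME draft `D/res-type-017/F2MulMemSW.draft.lean` sha16 bdce8e4044e558d2, farm-clean; carried summit-side with the namespace moved
# under `Summit.…Theorems.Campaign.W12.F2CellSW` and docstrings completed; Lean terms otherwise byte-identical)

WHAT IS DECIDED (a SCORED-CELL kernel, NOT a verdict): for the W1.2 candidate value `T(−a) := Campaign.sandwichPNega p e P m a`
(`MarkedTransferCampaignW12SandwichTSharp.lean`, row 008 re-based on `ρ^e(O)`) and its value-type variant SWρ
`T_ρ(−a) := Campaign.sandwichPNegaRho p e P m a` (`MarkedTransferCampaignW12SandwichRho.lean`, res-L1-type-o2 p488714), the V3 field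
shape F2 `mul_mem` («`a ∈ tilde P i → b ∈ tilde P j → a·b ∈ tilde P (i+j)`») FAILS at the GUARDED model `A = 𝔽₂[x]`
(`MvPolynomial (Fin 1) (ZMod 2)`), `P j = (x)^j` (`IsCharFiltration (ZMod 2) P` — res-adj-1's `mPow` instance re-proved), sandwich base
`ρ(A) = 𝔽₂[x²]` (`p = 2`, `e = 1`), `m = 3`: `x² ∈ T(−1), T(−3)` but `x²·x² = x⁴ ∉ T(−4), T(−6)` — ✗ in BOTH divisibility cases `m ∣ i`
(`i = j = −3`) and `m ∤ i` (`i = −1`); the same witness decides SWρ (`x² = ∂(x³)` is a generator VALUE, `x⁴ ∉ T ⊇ T_ρ`).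
MATHEMATICS (one variable, `q = p^e = 2`, `Diff_{A/ρ(A)} = A·id ⊕ A·∂`, `∂ = d/dx` of order 1): `T(−a) = Σ_{d : 3d ≥ a}
Diff^{(3d+a)}_{A/𝔽₂[x²]}((x^{3d}))`. For `a ≤ 3` the summand `d = 1` contains `∂(x³) = 3x² = x²`. For `4 ≤ c` every summand has `d ≥ 2`,
so acts on `(x^{3d}) ⊆ (x⁶) = x⁶·A` with `x⁶ = ρ(x³)` a SANDWICH CONSTANT: `D(x⁶ g) = x⁶ D(g)`, whence `T(−c) ⊆ (x⁶) ∌ x⁴`.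
REMARK (res-type-017's hand computation, NOT kernel, no side taken): in this model `T(−c) = (x^{q⌊m⌈c/m⌉/q⌋})`, so the product rule holds
iff `q ∣ m` — the obstruction is `q ∤ m`, not `m ∤ i` (Def 5.1 lets `m` be replaced by a multiple, p.26 L24 / p.28 L4–L6 — whether the SW
candidate should fix `m ∈ qℤ` is the scorer's F2 reading call).

HONEST FRAMING. Statements about OURS objects (`Campaign.sandwichPNega`, `Campaign.sandwichPNegaRho`, `Campaign.IsCharFiltration`);
Def 5.1 / Lem 5.8 of H. Hironaka's manuscript (2017-03-23, [Hironaka2017], lit key `paper:url-3343fd9e678b`; p.25 L31–L44, p.28 L7–L17)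
enter only as the typed SHAPES these OURS objects replace, CANDIDATES [claim: Hironaka2017, status: under-review]; nothing of the
manuscript is asserted. The model definitions `A`, `em`, `P`, `T`, `Tρ` below are MODEL DATA for this one kernel, not OURS decls of
record (no OURS-desk row needed). AI proof, weaker than expert review; nothing here is progress on resolution of singularities in
positive characteristic; no claim beyond the kernel.
-/

noncomputable section

open MvPolynomial
open Literature.AlgebraicGeometry.Resolution
open Literature.AlgebraicGeometry.Hironaka2017
open Summit.ResolutionOfSingularities.ResolutionOfSingularities.Theorems.Campaign
open Summit.ResolutionOfSingularities.ResolutionOfSingularities.Theorems.Campaign.W12 (apply_mem_sandwichPNega)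

set_option linter.dupNamespace false -- mandated namespace of this single-conjunct summit

namespace Summit.ResolutionOfSingularities.ResolutionOfSingularities.Theorems.Campaign.W12.F2CellSW

/-! ## The model: `A = 𝔽₂[x]`, `𝔪 = (x)`, `P j = 𝔪^j` -/

/-- The affine line over `𝔽₂` as a one-variable `MvPolynomial` (the shape of res-adj-1's `mPow` instance). [folklore] -/
abbrev A : Type := MvPolynomial (Fin 1) (ZMod 2)

/-- `𝔪 = (x)`. [folklore] -/
def em : Ideal A := Ideal.span {X 0}

/-- The `𝔪`-adic filtration `P j = (x)^j` (the (37)-datum at the origin: `g = x^m ∈ P m`, `ord g = m`). [folklore] -/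
def P (j : ℕ) : Ideal A := em ^ j

/-- `P j = (x^j)`. [folklore] -/
theorem P_eq_span (j : ℕ) : P j = Ideal.span {(X 0 : A) ^ j} := by
  rw [P, em, Ideal.span_singleton_pow]

/-- `x^j ∈ P j`. [folklore] -/
theorem X_pow_mem_P (j : ℕ) : (X 0 : A) ^ j ∈ P j := by
  rw [P_eq_span]; exact Ideal.mem_span_singleton_self _

/-- **The guard C2 holds at the model** (`P 0 = ⊤`, antitone, multiplicative, `Diff^{(μ)}_{A/𝔽₂} 𝔪^a ⊆ 𝔪^{a−μ}` by the tree's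
`diffIdeal_le_pow_sub`) — re-proof of res-adj-1's `isCharFiltration_mPow`. [folklore] -/
theorem isCharFiltration_P : IsCharFiltration (ZMod 2) P := by
  refine ⟨?_, ?_, ?_, ?_⟩
  · rw [P, pow_zero, Ideal.one_eq_top]
  · intro i j h; exact Ideal.pow_le_pow_right h
  · intro i j; rw [P, P, P, ← pow_add]
  · intro a μ _; exact diffIdeal_le_pow_sub (ZMod 2) le_rfl μ

/-! ## The sandwich pieces `T(−a) = Campaign.sandwichPNega 2 1 P 3 a` at the model -/

/-- `T(−a)` for the model: `p = 2`, `e = 1`, `m = 3`. [folklore] -/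
abbrev T (a : ℕ) : Ideal A := sandwichPNega (O := A) 2 1 P 3 a

/-- `(3 : A) = 1` in characteristic `2`. [folklore] -/
theorem three_eq_one : ((3 : ℕ) : A) = 1 := by
  rw [show (3 : ℕ) = 2 + 1 from rfl, Nat.cast_add, CharP.cast_eq_zero, zero_add, Nat.cast_one]

/-- **`x² ∈ T(−a)` for `a ≤ 3`**: the summand `d = 1` of Eq. (36) re-based, with the sandwich operator `∂ = ∂^{(1)}` (a box Hasse
derivative, `ρ`-linear of order `1 ≤ 3 + a`, `W12.exists_sandwichOp_hasseDeriv`) applied to `x³ ∈ P 3`: `∂(x³) = 3x² = x²`. [folklore] -/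
theorem X_sq_mem_T {a : ℕ} (ha : a ≤ 3) : (X 0 : A) ^ 2 ∈ T a := by
  classical
  have hγ : ∀ i : Fin 1, (Finsupp.single (0 : Fin 1) 1) i < 2 ^ 1 := by
    intro i
    fin_cases i
    simp
  obtain ⟨D, hD, hDf⟩ := W12.exists_sandwichOp_hasseDeriv (R := ZMod 2) (σ := Fin 1) 2 1 hγ
  have hdeg : (Finsupp.single (0 : Fin 1) 1).degree = 1 := by simp [Finsupp.degree_single]
  rw [hdeg] at hD
  have hmem := apply_mem_sandwichPNega (O := A) 2 1 P 3 a 1 (by omega) (by norm_num) (hD.of_le (by omega))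
    (f := (X 0 : A) ^ 3) (by simpa using X_pow_mem_P 3)
  rw [hDf, hasseDeriv_X_pow, Nat.choose_one_right, three_eq_one, one_mul] at hmem
  simpa using hmem

/-- `x⁶ = ρ(x³)` is a sandwich constant: every `ρ`-linear endomorphism `D` of `A` satisfies `D(g·x⁶) = D(g)·x⁶`, so `(x⁶)` is
`D`-stable. [folklore] -/
theorem apply_mem_span_X6 (D : A →ₗ[↥(iterateFrobenius A 2 1).range] A) {f : A} (hf : f ∈ Ideal.span {(X 0 : A) ^ 6}) :
    D f ∈ Ideal.span {(X 0 : A) ^ 6} := by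
  obtain ⟨g, rfl⟩ := Ideal.mem_span_singleton'.mp hf
  have h6 : (X 0 : A) ^ 6 = iterateFrobenius A 2 1 ((X 0 : A) ^ 3) := by
    rw [iterateFrobenius_def, ← pow_mul]; norm_num
  let r : ↥(iterateFrobenius A 2 1).range := ⟨(X 0 : A) ^ 6, ⟨(X 0 : A) ^ 3, h6.symm⟩⟩
  have hsmul : g * (X 0 : A) ^ 6 = r • g := by rw [Subring.smul_def, smul_eq_mul, mul_comm]
  rw [hsmul, LinearMap.map_smul, Subring.smul_def, smul_eq_mul]
  change (X 0 : A) ^ 6 * D g ∈ _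
  exact Ideal.mul_mem_right _ _ (Ideal.mem_span_singleton_self _)

/-- **`T(−c) ⊆ (x⁶)` for `4 ≤ c`**: the condition `3d ≥ |c|` of Eq. (36) forces `d ≥ 2`, the source piece is `P(3d) ⊆ (x⁶)`, and `(x⁶)`
is stable under every sandwich operator (`apply_mem_span_X6`). [folklore] -/
theorem T_le_span_X6 {c : ℕ} (hc : 4 ≤ c) : T c ≤ Ideal.span {(X 0 : A) ^ 6} := by
  unfold T sandwichPNega S05NegativePart.pNega S05NegativePart.pTildeNeg
  refine iSup₂_le fun d hd => ?_
  have hd2 : (2 : ℤ) ≤ d := by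
    rw [Nat.abs_cast] at hd
    push_cast at hd
    omega
  unfold S05NegativePart.DD
  refine (diffIdeal_le_iff _).mpr fun D _ f hf => apply_mem_span_X6 D ?_
  -- the source piece `pPosi P (3d) = P (3d) ⊆ P 6 = (x⁶)`
  have hd6 : 6 ≤ (d * (3 : ℕ)).toNat := by
    have : (6 : ℤ) ≤ d * 3 := by omega
    omega
  have hsrc : S05NegativePart.pPosi P (d * (3 : ℕ)).toNat ≤ P 6 := by
    unfold S05NegativePart.pPosi
    split_ifs with h0
    · exact bot_le
    · exact Ideal.pow_le_pow_right hd6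
  rw [← P_eq_span]
  exact hsrc hf

/-- `x⁴ ∉ (x⁶)` in `𝔽₂[x]` (degrees, after passing to `Polynomial` by `aeval`). [folklore] -/
theorem X4_not_mem_span_X6 : (X 0 : A) ^ 4 ∉ Ideal.span {(X 0 : A) ^ 6} := by
  intro h
  obtain ⟨g, hg⟩ := Ideal.mem_span_singleton'.mp h
  have hdvd : (Polynomial.X : Polynomial (ZMod 2)) ^ 6 ∣ Polynomial.X ^ 4 := by
    have h' := congrArg (MvPolynomial.aeval (R := ZMod 2) fun _ : Fin 1 => (Polynomial.X : Polynomial (ZMod 2))) hg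
    simp only [map_mul, map_pow, MvPolynomial.aeval_X] at h'
    exact ⟨_, by rw [← h', mul_comm]⟩
  have hdeg := Polynomial.natDegree_le_of_dvd hdvd (pow_ne_zero 4 Polynomial.X_ne_zero)
  simp at hdeg

/-! ## The ✗-witnesses for F2 `mul_mem` × SW -/

/-- `x⁴ = x²·x²`. [folklore] -/
theorem X4_eq : (X 0 : A) ^ 4 = X 0 ^ 2 * X 0 ^ 2 := by rw [← pow_add]

/-- **F2 `mul_mem` ✗ for SW, case `m ∣ i`**: `T(−3)·T(−3) ⊄ T(−6)` (`x²·x² = x⁴`). [folklore] -/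
theorem not_mul_le_div : ¬ T 3 * T 3 ≤ T 6 := by
  intro h
  have hmem : (X 0 : A) ^ 2 * X 0 ^ 2 ∈ T 3 * T 3 := Ideal.mul_mem_mul (X_sq_mem_T (a := 3) le_rfl) (X_sq_mem_T (a := 3) le_rfl)
  have h4 : (X 0 : A) ^ 4 ∈ Ideal.span {(X 0 : A) ^ 6} := by
    rw [X4_eq]; exact T_le_span_X6 (c := 6) (by norm_num) (h hmem)
  exact X4_not_mem_span_X6 h4

/-- **F2 `mul_mem` ✗ for SW, case `m ∤ i`**: `T(−1)·T(−3) ⊄ T(−4)` (`x²·x² = x⁴`). [folklore] -/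
theorem not_mul_le_ndiv : ¬ T 1 * T 3 ≤ T 4 := by
  intro h
  have hmem : (X 0 : A) ^ 2 * X 0 ^ 2 ∈ T 1 * T 3 :=
    Ideal.mul_mem_mul (X_sq_mem_T (a := 1) (by norm_num)) (X_sq_mem_T (a := 3) le_rfl)
  have h4 : (X 0 : A) ^ 4 ∈ Ideal.span {(X 0 : A) ^ 6} := by
    rw [X4_eq]; exact T_le_span_X6 (c := 4) le_rfl (h hmem)
  exact X4_not_mem_span_X6 h4

/-- **The cell in the shape of the V3 field `mul_mem`** (`∀ i j a b, a ∈ tilde P i → b ∈ tilde P j → a·b ∈ tilde P (i+j)`) for the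
SW candidate value in non-positive degrees `tilde P (−a) := T(−a)` (positive degrees by fiat `P i`, irrelevant here): at the
GUARDED model (`isCharFiltration_P`) there are `i = j = −3` (resp. `i = −1`, `j = −3`), `a = b = x²` with `a ∈ T(−i)`, `b ∈ T(−j)`,
`a·b ∉ T(−(i+j))`. [folklore] -/
theorem F2_mul_mem_SW_fails :
    IsCharFiltration (ZMod 2) P ∧
      (∃ a b : A, a ∈ T 3 ∧ b ∈ T 3 ∧ a * b ∉ T 6) ∧ (∃ a b : A, a ∈ T 1 ∧ b ∈ T 3 ∧ a * b ∉ T 4) := by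
  refine ⟨isCharFiltration_P,
    ⟨X 0 ^ 2, X 0 ^ 2, X_sq_mem_T (a := 3) le_rfl, X_sq_mem_T (a := 3) le_rfl, fun h => ?_⟩,
    ⟨X 0 ^ 2, X 0 ^ 2, X_sq_mem_T (a := 1) (by norm_num), X_sq_mem_T (a := 3) le_rfl, fun h => ?_⟩⟩
  · exact X4_not_mem_span_X6 (by rw [X4_eq]; exact T_le_span_X6 (c := 6) (by norm_num) h)
  · exact X4_not_mem_span_X6 (by rw [X4_eq]; exact T_le_span_X6 (c := 4) le_rfl h)

/-! ## The same witness for the value-type variant SWρ (`Campaign.sandwichPNegaRho`, `ρ`-modules) -/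

/-- `T_ρ(−a)` for the model: the `ρ`-MODULE pieces of SWρ (`p = 2`, `e = 1`, `m = 3`). [folklore] -/
abbrev Tρ (a : ℕ) : Submodule (↥(iterateFrobenius A 2 1).range) A := sandwichPNegaRho (O := A) 2 1 P 3 a

/-- **`x² ∈ T_ρ(−a)` for `a ≤ 3`**: `x² = ∂(x³)` is a generator VALUE (`hasseDeriv_mem_sandwichPNegaRho`, summand `d = 1`). [folklore] -/
theorem X_sq_mem_Tρ {a : ℕ} (ha : a ≤ 3) : (X 0 : A) ^ 2 ∈ Tρ a := by
  classical
  have hγ : ∀ i : Fin 1, (Finsupp.single (0 : Fin 1) 1) i < 2 ^ 1 := by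
    intro i
    fin_cases i
    simp
  have hdeg : (Finsupp.single (0 : Fin 1) 1).degree ≤ 1 * 3 + a := by simp [Finsupp.degree_single]; omega
  have hmem := hasseDeriv_mem_sandwichPNegaRho (R := ZMod 2) (σ := Fin 1) 2 1 P 3 a 1 (by omega) (by norm_num) hγ hdeg
    (f := (X 0 : A) ^ 3) (by simpa using X_pow_mem_P 3)
  rw [hasseDeriv_X_pow, Nat.choose_one_right, three_eq_one, one_mul] at hmem
  simpa using hmem

/-- **`T_ρ(−c) ⊆ (x⁶)` for `4 ≤ c`** (`T_ρ ⊆ T` as sets, `sandwichPNegaRho_subset`, then `T_le_span_X6`). [folklore] -/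
theorem Tρ_subset_span_X6 {c : ℕ} (hc : 4 ≤ c) : (Tρ c : Set A) ⊆ (Ideal.span {(X 0 : A) ^ 6} : Set A) :=
  (sandwichPNegaRho_subset (O := A) 2 1 P 3 c).trans (T_le_span_X6 hc)

/-- **F2 `mul_mem` ✗ for SWρ at the guarded model**, both divisibility cases, with `a = b = x²`: `x² ∈ T_ρ(−1), T_ρ(−3)`,
`x⁴ ∉ T_ρ(−4), T_ρ(−6)`. [folklore] -/
theorem F2_mul_mem_SWrho_fails :
    IsCharFiltration (ZMod 2) P ∧
      (∃ a b : A, a ∈ Tρ 3 ∧ b ∈ Tρ 3 ∧ a * b ∉ Tρ 6) ∧ (∃ a b : A, a ∈ Tρ 1 ∧ b ∈ Tρ 3 ∧ a * b ∉ Tρ 4) := by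
  refine ⟨isCharFiltration_P,
    ⟨X 0 ^ 2, X 0 ^ 2, X_sq_mem_Tρ (a := 3) le_rfl, X_sq_mem_Tρ (a := 3) le_rfl, fun h => ?_⟩,
    ⟨X 0 ^ 2, X 0 ^ 2, X_sq_mem_Tρ (a := 1) (by norm_num), X_sq_mem_Tρ (a := 3) le_rfl, fun h => ?_⟩⟩
  · exact X4_not_mem_span_X6 (by rw [X4_eq]; exact Tρ_subset_span_X6 (c := 6) (by norm_num) h)
  · exact X4_not_mem_span_X6 (by rw [X4_eq]; exact Tρ_subset_span_X6 (c := 4) le_rfl h)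

/-! ## Revision 2 (APPEND-ONLY; the declarations above are byte-identical to rev. 1 p491700): the ✓ HALF of the cell at `q ∣ m` —
same guarded model `𝔽₂[x]`, `P = (x)`-adic, `p = 2`, `e = 1`, now `m = 2` (res-adj-1 SCORES DELTA 2 (9) 2026-08-27T03:23:16Z: «q ∣ m:
hand ✓ — kernel it if cheap (same model, m = 2 or 4)»; res-L1-type-o2 03:26:22Z: append here). EXACT SHAPE of the pieces:
`T₂(−a) = (x^{2·k(a)})`, `k(a) = ⌈max(a,1)/2⌉` (upper bound: every summand `d` acts on `(x^{2d}) = ρ(x^d)·A`, a sandwich constant;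
lower bound: the identity operator at `d = k(a)`); hence the V3 field `mul_mem` HOLDS for the SW value `tilde₂ i :=
(P i for i > 0 | T₂(−i) for i ≤ 0)` — all four sign cases reduce to `n(i+j) ≤ n(i) + n(j)` for the exponents. A MODEL INSTANCE of ✓
(one variable, q = 2 ∣ m = 2), not a proof of the product rule for SW in general; reading stays the scorer's. -/

/-- `T₂(−a)` for the model at `m = 2` (so `q = 2 ∣ m`). MODEL DEFINITION, not an OURS decl of record. [folklore] -/
abbrev T2 (a : ℕ) : Ideal A := sandwichPNega (O := A) 2 1 P 2 a

/-- The exponent `2·k(a)`, `k(a) = ⌈max(a,1)/2⌉`, of the monomial generating `T₂(−a)`. MODEL DEFINITION. [folklore] -/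
def texp (a : ℕ) : ℕ := 2 * ((max a 1 + 1) / 2)

/-- `a ≤ texp a`, `2 ≤ texp a`, `texp a` even — the arithmetic of `k(a)`. [folklore] -/
theorem le_texp (a : ℕ) : a ≤ texp a ∧ 2 ≤ texp a := by unfold texp; omega

/-- Even powers of `x` are sandwich constants: every `ρ`-linear `D` maps `(x^{2n}) = ρ(x^n)·A` into itself. [folklore] -/
theorem apply_mem_span_X_pow_even (D : A →ₗ[↥(iterateFrobenius A 2 1).range] A) (n : ℕ) {f : A}
    (hf : f ∈ Ideal.span {(X 0 : A) ^ (2 * n)}) : D f ∈ Ideal.span {(X 0 : A) ^ (2 * n)} := by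
  obtain ⟨g, rfl⟩ := Ideal.mem_span_singleton'.mp hf
  have h6 : (X 0 : A) ^ (2 * n) = iterateFrobenius A 2 1 ((X 0 : A) ^ n) := by
    rw [iterateFrobenius_def, ← pow_mul]; ring_nf
  let r : ↥(iterateFrobenius A 2 1).range := ⟨(X 0 : A) ^ (2 * n), ⟨(X 0 : A) ^ n, h6.symm⟩⟩
  have hsmul : g * (X 0 : A) ^ (2 * n) = r • g := by rw [Subring.smul_def, smul_eq_mul, mul_comm]
  rw [hsmul, LinearMap.map_smul, Subring.smul_def, smul_eq_mul]
  change (X 0 : A) ^ (2 * n) * D g ∈ _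
  exact Ideal.mul_mem_right _ _ (Ideal.mem_span_singleton_self _)

/-- **Upper bound `T₂(−a) ⊆ (x^{texp a})`**: a summand `d` of Eq. (36) re-based is `⊥` if `2d ≤ 0`, and otherwise acts on
`P(2d) = (x^{2d})`, stable under sandwich operators, with `2d ≥ texp a` forced by `2d ≥ a`, `d ≥ 1`. [folklore] -/
theorem T2_le (a : ℕ) : T2 a ≤ Ideal.span {(X 0 : A) ^ texp a} := by
  unfold T2 sandwichPNega S05NegativePart.pNega S05NegativePart.pTildeNeg
  refine iSup₂_le fun d hd => ?_
  rw [Nat.abs_cast] at hd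
  unfold S05NegativePart.DD S05NegativePart.pPosi
  split_ifs with h0
  · rw [diffIdeal_bot]; exact bot_le
  · -- `d ≥ 1`; the source is `P (2d') = (x^{2d'})` with `d' = d.toNat`, `2 d' ≥ texp a`
    have hd1 : (1 : ℤ) ≤ d := by
      by_contra hlt
      apply h0
      have : d * (2 : ℕ) ≤ 0 := by push_cast; nlinarith
      exact Int.toNat_of_nonpos this
    obtain ⟨d', rfl⟩ : ∃ d' : ℕ, d = (d' : ℤ) := ⟨d.toNat, (Int.toNat_of_nonneg (by omega)).symm⟩
    have hcast : ((d' : ℤ) * (2 : ℕ)).toNat = 2 * d' := by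
      rw [show ((d' : ℤ) * (2 : ℕ)) = ((2 * d' : ℕ) : ℤ) by push_cast; ring, Int.toNat_natCast]
    rw [hcast]
    have hle : texp a ≤ 2 * d' := by
      have : (a : ℤ) ≤ (d' : ℤ) * 2 := by exact_mod_cast hd
      unfold texp; omega
    refine (diffIdeal_le_iff _).mpr fun D _ f hf => ?_
    have hf' : f ∈ Ideal.span {(X 0 : A) ^ (2 * d')} := by rw [← P_eq_span]; exact hf
    have hDf := apply_mem_span_X_pow_even D d' hf'
    exact Ideal.span_singleton_le_span_singleton.mpr (pow_dvd_pow _ hle) hDf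

/-- **Lower bound `x^{texp a} ∈ T₂(−a)`**: the identity is a sandwich operator (order `0 ≤ 2d + a`) at the summand `d = texp a / 2`,
`x^{2d} ∈ P(2d)`. [folklore] -/
theorem X_pow_texp_mem_T2 (a : ℕ) : (X 0 : A) ^ texp a ∈ T2 a := by
  have h := le_texp a
  have hd : texp a = (texp a / 2) * 2 := by unfold texp; omega
  have hmem := apply_mem_sandwichPNega (O := A) 2 1 P 2 a (texp a / 2) (by omega) (by omega)
    (D := LinearMap.id) ((isDiffOpLE_id (R := ↥(iterateFrobenius A 2 1).range) (A := A)).of_le (Nat.zero_le _))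
    (f := (X 0 : A) ^ texp a) (by rw [← hd]; exact X_pow_mem_P _)
  simpa using hmem

/-- **`T₂(−a) = (x^{texp a})` exactly** (`m = 2`, `q = 2`). [folklore] -/
theorem T2_eq (a : ℕ) : T2 a = Ideal.span {(X 0 : A) ^ texp a} :=
  le_antisymm (T2_le a) ((Ideal.span_singleton_le_iff_mem _).mpr (X_pow_texp_mem_T2 a))

/-- The SW candidate value at the model, `m = 2`: positive degrees BY FIAT `P i`, non-positive degrees the sandwich pieces `T₂(−i)`.
MODEL DEFINITION. [folklore] -/
def tilde2 (i : ℤ) : Ideal A := if 0 < i then P i.toNat else T2 (-i).toNat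

/-- The exponent of the monomial generating `tilde2 i`. MODEL DEFINITION. [folklore] -/
def nexp (i : ℤ) : ℕ := if 0 < i then i.toNat else texp (-i).toNat

/-- `tilde2 i = (x^{nexp i})`. [folklore] -/
theorem tilde2_eq (i : ℤ) : tilde2 i = Ideal.span {(X 0 : A) ^ nexp i} := by
  unfold tilde2 nexp
  split_ifs with h
  · exact P_eq_span _
  · exact T2_eq _

/-- **The exponent inequality behind `mul_mem`**: `nexp (i + j) ≤ nexp i + nexp j` for all `i j : ℤ` (four sign cases; `texp a =
2⌈max(a,1)/2⌉`). [folklore] -/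
theorem nexp_add_le (i j : ℤ) : nexp (i + j) ≤ nexp i + nexp j := by
  unfold nexp texp
  rcases Int.eq_nat_or_neg i with ⟨a, rfl | rfl⟩ <;> rcases Int.eq_nat_or_neg j with ⟨b, rfl | rfl⟩ <;>
    split_ifs <;> omega

/-- **F2 `mul_mem` ✓ for SW at the guarded model with `q ∣ m` (`m = 2`)**, in the shape of the V3 field: for all `i j : ℤ`,
`a ∈ tilde2 i`, `b ∈ tilde2 j` ⇒ `a·b ∈ tilde2 (i + j)` — products of monomial ideals, `nexp_add_le`. Together with
`F2_mul_mem_SW_fails` (`m = 3`, `q ∤ m`, ✗) this is the two-sided record of the cell AT THIS MODEL: the obstruction is `q ∤ m`.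
A MODEL INSTANCE, not the product rule for SW in general. [folklore] -/
theorem F2_mul_mem_SW_holds_m2 :
    IsCharFiltration (ZMod 2) P ∧
      ∀ (i j : ℤ) (a b : A), a ∈ tilde2 i → b ∈ tilde2 j → a * b ∈ tilde2 (i + j) := by
  refine ⟨isCharFiltration_P, fun i j a b ha hb => ?_⟩
  rw [tilde2_eq] at ha hb ⊢
  have hab : a * b ∈ Ideal.span {(X 0 : A) ^ (nexp i + nexp j)} := by
    rw [pow_add, ← Ideal.span_singleton_mul_span_singleton]
    exact Ideal.mul_mem_mul ha hb
  exact Ideal.span_singleton_le_span_singleton.mpr (pow_dvd_pow _ (nexp_add_le i j)) hab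


end Summit.ResolutionOfSingularities.ResolutionOfSingularities.Theorems.Campaign.W12.F2CellSW

end
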